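import Summits.BirchSwinnertonDyer.BirchSwinnertonDyer.Theorems.KolyvaginDepthDoorKolyvaginDepthSupplyLeavesOfPrint
import Summits.BirchSwinnertonDyer.BirchSwinnertonDyer.Theorems.KolyvaginDepthDoorDepthTableRowRankThree5077a1NoTwist
import HarnessLib

/-!
# Route `KolyvaginDepthDoor` — rank-3 DEPTH-TWO depth-table rows, rows `5077a1`, ON (γ) + F1
# (crux `KolyvaginDepthSupply`, stmt-BirchSwinnertonDyer-21765) — part 1 of 5

Helper file (`--supports stmt-BirchSwinnertonDyer-21765 --as helper`); it closes nothing and BSD is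
not proved by it.

g6/g7's rows of this family display the FIVE named McCallum / Gross leaves (`h54 h43 h44 h53 h22`). After
g8 three of them are tree THEOREMS as stated (`sign_conjAct_kolyvaginClass_holds`,
`lemma53_selmer_eigen_dependent_at_holds`, `prop22_reciprocity_eigen_finset_holds`), Lemma 4.3 follows
from F1 = `Gross1991_heegnerPoint_sub_ratTorsion_mem_E0` ([GZ86 III (3.1)]) and Prop. 4.4 from
(γ) = `GrossLMS1991.prop37_2_frobeniusCongruence` (Gross 1991 Prop. 3.7 (2)) — packaged as
`mcCallumLeaves_of_print` (file `…LeavesOfPrint`). This file re-issues the rows over the fed kit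
`depthRowTwo_print_of_datum_of_intModel_certificate`: same per-curve certificates, binders `(h372 : (γ)) (hE0 : F1)` in place of the five
leaves. CONDITIONAL on (γ) + F1 and the bit; per-curve; BSD is not proved by it.
-/

set_option linter.dupNamespace false

noncomputable section

open scoped Classical

namespace Summit.BirchSwinnertonDyer.BirchSwinnertonDyer.Theorems.KolyvaginDepthDoor

open Literature.NumberTheory.EllipticCurves Literature.NumberTheory.EllipticCurves.ModularForms
  Literature.NumberTheory.EllipticCurves.McCallum1991 WeierstrassCurve
open Summit.BirchSwinnertonDyer.BirchSwinnertonDyer.Theorems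
open Summit.BirchSwinnertonDyer.BirchSwinnertonDyer.Rank2Observatory
open Summit.BirchSwinnertonDyer.BirchSwinnertonDyer.Rank1Residual
open Summit.BirchSwinnertonDyer.Rank1Residual.Additive

namespace C5077a1

/-- **DEPTH-TWO ROW `5077a1`, `(p, d_K, ℓ₁ℓ₂) = (5, −7, 229·349)`, twist-free, without Kolyvagin's
structure theorem, NO SYSTEM (bit at ANY datum).** For `E = 5077a1` (rank `3`), ANY imaginary
quadratic `K` with `d_K = −7`, any frame `(Dt, β, ι)` and ANY single Kolyvagin–Heegner datum `d` of
conductor `229·349` (no system, no coherence binders), granted the two Literature facts (γ) [Gross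
3.7 (2)] and F1 [GZ86 III (3.1)] in place of the five named leaves (Gross Prop. 5.4 (2); McCallum
Lemma 4.3, Prop. 4.4, Lemma 5.3, Prop. 2.2): IF the depth-2 derived class on the two Kolyvagin
primes `229, 349` does not vanish, `d.kolyvaginClass _ 1 ≠ 0` (`d` of conductor `229·349`), THEN
`corank_{ℤ_5} Ш(E)[5^∞] = 0`, `rank_ℤ E(ℚ) = 3`, `rank_ℤ E^{(−7)}(ℚ) ≤ 2`, `E(ℚ)[5] = 0`, `Ш(E/ℚ)[5]
= 0`, `#Sel^(5)(E/ℚ) = 5³` and `#Sel^(5)(E^{(−7)}/ℚ) ≤ 5²`. Every side condition (`5 ∈ B(E)`,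
non-CM, Heegner hypothesis, both Kolyvagin primes, `3 ≤ rank`) is a kernel theorem. CONDITIONAL on
(γ) + F1 and the bit; per-curve; BSD is not proved by it. [cite: Kolyvagin1991MathAnn, Thm. 2.3]
[cite: McCallumLMS1991, §§2–5] [cite: GrossLMS1991, §5 (5.1)] [cite: CremonaAlgorithms1997, Table 1
(5077a1)] -/
theorem depthRow_5_neg7_229_349_print
    (h372 : GrossLMS1991.prop37_2_frobeniusCongruence)
    (hE0 : Gross1991_heegnerPoint_sub_ratTorsion_mem_E0)
    (K : Type) [Field K] [NumberField K] (hK : IsImaginaryQuadratic K)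
    (hD : NumberField.discr K = -7) :
    haveI := isElliptic_of_mem_atlasR3A00 mem_atlas;
    haveI := isGloballyMinimal_of_mem_atlasR3A00 mem_atlas;
    haveI : NeZero ((c5077a1.e.baseChange ℚ).conductorNorm ℤ) := neZero_conductorNorm_of_isElliptic _;
    ∀ (Dt : ModularParametrizationData (c5077a1.e.baseChange ℚ) ((c5077a1.e.baseChange ℚ).conductorNorm ℤ))
      (β : ℤ) (ι : K →+* ℂ) (d : KolyvaginHeegnerData Dt β ι (229 * 349)),
    d.kolyvaginClass (p := 5) (by norm_num) 1 ≠ 0 →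
    (c5077a1.e.baseChange ℚ).shaCorank 5 = 0 ∧ (c5077a1.e.baseChange ℚ).mordellWeilRank = 3 ∧
      ((c5077a1.e.baseChange ℚ).quadraticTwist ((-7 : ℤ) : ℚ)).mordellWeilRank ≤ 2 ∧
      (∀ P : (c5077a1.e.baseChange ℚ).toAffine.Point, 5 • P = 0 → P = 0) ∧
      (∀ x ∈ (c5077a1.e.baseChange ℚ).sha, 5 • x = 0 → x = 0) ∧
      Nat.card ↥(selmerGroup (c5077a1.e.baseChange ℚ) ((5 : ℕ) : ℤ)) = 5 ^ 3 ∧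
      Nat.card ↥(selmerGroup ((c5077a1.e.baseChange ℚ).quadraticTwist ((-7 : ℤ) : ℚ))
        ((5 : ℕ) : ℤ)) ≤ 5 ^ 2 := by
  haveI := isElliptic_of_mem_atlasR3A00 mem_atlas
  haveI := isGloballyMinimal_of_mem_atlasR3A00 mem_atlas
  haveI : NeZero ((c5077a1.e.baseChange ℚ).conductorNorm ℤ) := neZero_conductorNorm_of_isElliptic _
  intro Dt β ι d hne
  haveI := Fact.mk (by norm_num : Nat.Prime 5)
  exact depthRowTwo_print_of_datum_of_intModel_certificate intModel h372 hE0 not_hasCM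
    three_le_rank 5 (by norm_num) hasSurjectiveModNGaloisRep_pow_5 K hK hD (by norm_num) (by norm_num)
    heegner_neg7
    229 (by norm_num) (by norm_num) (by decide +kernel) (by norm_num) (by norm_num) (by norm_num)
    (by norm_num) (n₁ := 240) card_229 (by norm_num)
    349 (by norm_num) (by norm_num) (by decide +kernel) (by norm_num) (by norm_num) (by norm_num)
    (by norm_num) (n₂ := 385) card_349 (by norm_num) (by norm_num)
    Dt β ι d hne

end C5077a1

end Summit.BirchSwinnertonDyer.BirchSwinnertonDyer.Theorems.KolyvaginDepthDoor

end
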